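import Literature.Barriers.CriticalPhenomena.TreesPercolatingAtCriticality
import Literature.Barriers.CriticalPhenomena.TreesPercolatingAtCriticalityEstimates
import Literature.Barriers.CriticalPhenomena.SubexponentialGrowthZdProofs
import Literature.Probability.Percolation.BernoulliPercolation
import Literature.Probability.Percolation.BKFinitary
import Mathlib.Combinatorics.SimpleGraph.Acyclic
import Mathlib.Analysis.SpecificLimits.Basic
import HarnessLib

/-!
# Proofs of `CriticalTreesExponentialGrowth` and `TreesPercolatingAtCriticality` (Lyons–Peres 2016, §5.2–5.3, Exercise 5.12)

(Proofs for `TreesPercolatingAtCriticality.lean`.)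

This file discharges the named fact
`Literature.Barriers.CriticalPhenomena.CriticalTreesExponentialGrowth` of
`Literature/Barriers/CriticalPhenomena/TreesPercolatingAtCriticality.lean`:

> every locally finite tree `T` on `ℕ` with `p_c(T) < 1` (bond percolation, root `0`) has
> exponential volume growth: for every `x` there is `c > 1` with `c^n ≤ |B(x,n)|` eventually

as the sorry-free theorem `CriticalTreesExponentialGrowth_holds`.

## The printed proof (Lyons–Peres 2016, §5.2 pp. 137–139 and §1.2) and what is formalised

* Prop. 5.8 (the first-moment method / union bound): for every set `Π` separating `x` from
  infinity, `[x ↔ ∞] ⊆ ⋃_{e ∈ Π} [x ↔ e]`, hence `P[x ↔ ∞] ≤ Σ_{e ∈ Π} P[x ↔ e]` (5.4).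
* On a tree, "`P[o ↔ e] = p^{|e|+1}`" (all edges of the unique path must be open), whence
  `p_c(T) ≥ 1/br T` (5.6); and `br T ≤ gr T = liminf_n |T_n|^{1/n}` (1.1), whose proof is the
  computation `Σ_{x ∈ T_n} λ^{-n} = |T_n| λ^{-n}` over the level-`n` cutset.

We formalise the composite of these two displayed steps with the level-`n` cutset, bypassing
the branching number (which is not formalised): for the level set `T_n` (vertices at the end of
a path of length `n` from the root `o`),

* `percolatesAt_inter_subset_iUnion`:
  `[o ↔ ∞] ∩ {ω ⊆ E(T)} ⊆ ⋃_{y ∈ T_n} {all edges of the path o → y open}` (an infinite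
  cluster leaves the finite ball `B(o,n)`; the first `n` steps of the open path,
  `SimpleGraph.Walk.take`, form the unique path of `T` to a vertex of `T_n`,
  `SimpleGraph.IsAcyclic.path_unique`);
* `real_forall_path_edges_mem_eq_pow`: `P_p[all edges of the path o → y open] = p^n`, `y ∈ T_n`
  (`Literature.Probability.Percolation.bondPercolation_real_setOf_subset`);
* `theta_le_card_level_mul_pow`: **`θ_o(p) ≤ |T_n| · p^n`** for every `n` (Prop. 5.8 with
  the tree formula; `ω ⊆ E(T)` a.s. is Mathlib's `ProbabilityTheory.setBernoulli_ae_subset`),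
  and `theta_le_ballVolume_mul_pow`: `θ_o(p) ≤ |B(o,n)| · p^n`;
* `CriticalTreesExponentialGrowth_holds`: `p_c < 1` gives `p < 1` with `θ_o(p) > 0`
  (`exists_theta_pos_of_criticalProb_lt_one`, definition of `p_c` as an infimum), so
  `|B(o,n)| ≥ θ_o(p) p^{-n}` and, through `B(o,m) ⊆ B(x, m + d(x,o))`
  (`graphBall_subset_graphBall_add_length`), `c^n ≤ |B(x,n)|` eventually for `c = (1 + 1/p)/2`.

## Discharge of the barrier itself (appended)

`TreesPercolatingAtCriticality_holds : TreesPercolatingAtCriticality` — Lyons–Peres 2016,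
Exercise 5.12 / Exercise 5.51 (b): the spherically symmetric tree `CritTree.tree` of
`TreesPercolatingAtCriticalityTree.lean` (level sizes `|T_n| = 2ⁿ · 4^{size n} ≍ 2ⁿ n²`) has
`p_c = 1/2` (first moment, Prop. 5.8: `θ_o(p) ≤ |T_n| pⁿ → 0` for `p < 1/2`) and
`θ_o(1/2) ≥ 1/2` (second moment, Prop. 5.11 with (5.11) on each level cutset:
`P_{1/2}[o ↔ T_n] ≥ E[X_n]²/E[X_n²] ≥ 1/2`, then continuity along the decreasing events
`[o ↔ T_n]`, (5.9)); all estimates are in `TreesPercolatingAtCriticalityEstimates.lean`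
(`CritTree.criticalProb_eq_half`, `CritTree.half_le_theta_half`). Here the witness is moved to
the vertex type `ℕ` (root `0`) along a bijection `CritTree.Vert ≃ ℕ`
(`Denumerable.ofEncodableOfInfinite` and a swap), under which `IsTree`, local finiteness, `θ`
and `p_c` are invariant (`SimpleGraph.Iso.isTree_iff`, `CritTree.neighborSet_comap_equiv_finite`,
`CritTree.theta_comap_equiv`, `CritTree.criticalProb_comap_equiv`).

## References

* R. Lyons, Y. Peres, *Probability on Trees and Networks*, CUP 2016: §5.2, Prop. 5.8, (5.4),
  (5.6) (pp. 137–139); §1.2, (1.1); Thm. 1.8 / Thm. 5.15 (`p_c(T) = 1/br T`, not used);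
  §5.3 Prop. 5.11, (5.9), (5.11); Exercise 5.12; Exercise 5.51 (b).
  [LyonsPeres2016]
* R. Lyons, *Random walks and percolation on trees*, Ann. Probab. 18 (1990) 931–958, Thm. 6.2.
  [Lyons1990]
-/

noncomputable section

namespace Literature.Barriers.CriticalPhenomena

open _root_.MeasureTheory _root_.Filter _root_.ProbabilityTheory
open Literature.Probability.Percolation

variable {V : Type*}

/-! ### From `p_c < 1` to a percolating parameter `p < 1` -/

/-- If `p_c(G, x) < 1` then some `p < 1` already has `θ_x(p) > 0` (`p_c` is the infimum of
`{p | θ_x(p) > 0} ∪ {1}`). [cite: LyonsPeres2016, §5.2 (5.5)] -/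
theorem exists_theta_pos_of_criticalProb_lt_one (G : SimpleGraph V) (x : V)
    (h : criticalProb G x < 1) : ∃ p : unitInterval, (p : ℝ) < 1 ∧ 0 < theta G x p := by
  have h' : sInf ({q : ℝ | ∃ h : q ∈ unitInterval, 0 < theta G x ⟨q, h⟩} ∪ {1}) < 1 := h
  obtain ⟨q, hq, hq1⟩ := exists_lt_of_csInf_lt
    (⟨1, Or.inr rfl⟩ : ({q : ℝ | ∃ h : q ∈ unitInterval, 0 < theta G x ⟨q, h⟩} ∪ {1}).Nonempty) h'
  rcases hq with ⟨hq01, hθ⟩ | hq1'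
  · exact ⟨⟨q, hq01⟩, hq1, hθ⟩
  · exact absurd (Set.mem_singleton_iff.1 hq1') hq1.ne

/-- A parameter at which percolation occurs is positive: `θ_x(0) = 0`. [folklore] -/
theorem coe_pos_of_theta_pos [Countable V] (G : SimpleGraph V) (x : V) {p : unitInterval}
    (hθ : 0 < theta G x p) : 0 < (p : ℝ) := by
  refine lt_of_le_of_ne p.2.1 fun h => ?_
  have hp : p = 0 := Set.Icc.coe_eq_zero.1 h.symm
  rw [hp, theta_bot] at hθ
  exact lt_irrefl _ hθ

/-! ### Open paths in a tree are the unique paths -/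

/-- **On a tree, `[u ↔ v]` forces every edge of the path from `u` to `v` to be open** (the
content of "`P[o ↔ e] = p^{|e|+1}`": when only edges of `T` are open, the open walk, pushed into
`T` and shortened to a path, is THE path by `SimpleGraph.IsAcyclic.path_unique`; the edges of
an open walk are open, `Literature.Probability.Percolation.mem_of_mem_walk_edges`).
[cite: LyonsPeres2016, §5.2 (proof of (5.6))] -/
theorem forall_mem_edges_of_reachable [DecidableEq V] {T : SimpleGraph V} (hT : T.IsAcyclic)
    {ω : BondConfig V} (hle : openGraph ω ≤ T) {u v : V} (h : (openGraph ω).Reachable u v)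
    (q : T.Path u v) : ∀ e ∈ q.1.edges, e ∈ ω := by
  obtain ⟨w⟩ := h
  have hq : q = (w.mapLe hle).toPath := hT.path_unique _ _
  intro e he
  rw [hq] at he
  have he' : e ∈ (w.mapLe hle).edges := SimpleGraph.Walk.edges_toPath_subset_edges _ he
  rw [SimpleGraph.Walk.edges_mapLe_eq_edges] at he'
  exact mem_of_mem_walk_edges w he'

/-! ### Level sets `T_n` and balls -/

/-- The level set `T_n = {y | there is a path x → y of length n}` (for a tree rooted at `x`, the
`n`-th generation) lies in the ball `B(x, n)`. [cite: LyonsPeres2016, §1.2 (T_n)] -/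
theorem level_subset_graphBall (G : SimpleGraph V) (x : V) (n : ℕ) :
    {y | ∃ w : G.Walk x y, w.IsPath ∧ w.length = n} ⊆ graphBall G x n :=
  fun _ ⟨w, _, hw⟩ => ⟨w, hw.le⟩

/-- Level sets of a locally finite graph are finite. [folklore] -/
theorem level_finite (G : SimpleGraph V) [G.LocallyFinite] (x : V) (n : ℕ) :
    {y | ∃ w : G.Walk x y, w.IsPath ∧ w.length = n}.Finite :=
  (graphBall_finite G x n).subset (level_subset_graphBall G x n)

/-- `|T_n| ≤ |B(x, n)|`. [folklore] -/
theorem card_level_le_ballVolume (G : SimpleGraph V) [G.LocallyFinite] (x : V) (n : ℕ) :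
    (level_finite G x n).toFinset.card ≤ ballVolume G x n := by
  rw [ballVolume, ← Set.ncard_eq_toFinset_card _ (level_finite G x n)]
  exact Set.ncard_le_ncard (level_subset_graphBall G x n) (graphBall_finite G x n)

/-- `B(o, m) ⊆ B(x, m + d)` whenever there is a walk of length `d` from `x` to `o`. [folklore] -/
theorem graphBall_subset_graphBall_add_length (G : SimpleGraph V) {x o : V} (w : G.Walk x o)
    (m : ℕ) : graphBall G o m ⊆ graphBall G x (m + w.length) := by
  rintro y ⟨w', hw'⟩
  exact ⟨w.append w', by rw [SimpleGraph.Walk.length_append]; omega⟩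

/-! ### Prop. 5.8 on a tree: `θ_o(p) ≤ |T_n| p^n` -/

/-- **The level-`n` cutset separates `o` from infinity** (Prop. 5.8 applied on a tree): if the
open cluster of `o` is infinite (and only edges of `T` are open), then for every `n` some vertex
`y ∈ T_n` has all edges of the (unique) path `o → y` open. Proof: the cluster is not contained in
the finite ball `B(o, n)`; an open path to a vertex outside it has length `> n`, and its first
`n` steps (`SimpleGraph.Walk.take`) form the unique path of `T` to a vertex of `T_n`.
[cite: LyonsPeres2016, Prop. 5.8 (proof)] -/
theorem percolatesAt_inter_subset_iUnion [DecidableEq V] {T : SimpleGraph V} [T.LocallyFinite]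
    (hT : T.IsTree) (o : V) (n : ℕ) :
    percolatesAt o ∩ {ω | ω ⊆ T.edgeSet} ⊆
      ⋃ y ∈ {y | ∃ w : T.Walk o y, w.IsPath ∧ w.length = n},
        {ω : BondConfig V | ∀ q : T.Path o y, ∀ e ∈ q.1.edges, e ∈ ω} := by
  rintro ω ⟨hperc, hω⟩
  have hinf : (openCluster ω o).Infinite := hperc
  obtain ⟨z, hzC, hzB⟩ := (hinf.sdiff (graphBall_finite T o n)).nonempty
  have hreach : (openGraph ω).Reachable o z := hzC
  obtain ⟨w⟩ := hreach
  have hle : openGraph ω ≤ T := by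
    intro a b hab
    rw [openGraph_adj] at hab
    exact hω hab.1
  have hml : ∀ {v' : V} (w' : (openGraph ω).Walk o v'), (w'.mapLe hle).length = w'.length :=
    fun w' => SimpleGraph.Walk.length_map _ w'
  set q : (openGraph ω).Path o z := w.toPath with hq
  have hlen : n < q.1.length := by
    by_contra hn
    exact hzB ⟨q.1.mapLe hle, by rw [hml]; exact not_lt.1 hn⟩
  refine Set.mem_iUnion₂.2
    ⟨q.1.getVert n, ⟨(q.1.take n).mapLe hle, (q.2.take n).mapLe hle, ?_⟩, fun q' => ?_⟩
  · rw [hml, SimpleGraph.Walk.take_length]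
    exact min_eq_left hlen.le
  · exact forall_mem_edges_of_reachable hT.isAcyclic hle ⟨q.1.take n⟩ q'

/-- **`P_p[all edges of the path o → y open] = p^n` for `y ∈ T_n`** ("`P[o ↔ e] = p^{|e|+1}`":
the path has `n` distinct edges, each open independently with probability `p`; on a tree the
path is unique). [cite: LyonsPeres2016, §5.2 (proof of (5.6))] -/
theorem real_forall_path_edges_mem_eq_pow [DecidableEq V] {T : SimpleGraph V}
    (hT : T.IsAcyclic) (o : V) (p : unitInterval) {n : ℕ} {y : V}
    (hy : y ∈ {y | ∃ w : T.Walk o y, w.IsPath ∧ w.length = n}) :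
    (bondPercolation T p).real {ω : BondConfig V | ∀ q : T.Path o y, ∀ e ∈ q.1.edges, e ∈ ω} =
      (p : ℝ) ^ n := by
  obtain ⟨w, hw, hwn⟩ := hy
  have hset : {ω : BondConfig V | ∀ q : T.Path o y, ∀ e ∈ q.1.edges, e ∈ ω} =
      {ω | (↑w.edges.toFinset : Set (Sym2 V)) ⊆ ω} := by
    ext ω
    simp only [Set.mem_setOf_eq, Set.subset_def, List.coe_toFinset]
    exact ⟨fun h => h ⟨w, hw⟩, fun h q => by rw [hT.path_unique q ⟨w, hw⟩]; exact h⟩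
  have hF : (↑w.edges.toFinset : Set (Sym2 V)) ⊆ T.edgeSet := fun e he =>
    w.edges_subset_edgeSet (List.mem_toFinset.1 he)
  rw [hset, bondPercolation_real_setOf_subset T p _ hF,
    List.toFinset_card_of_nodup hw.isTrail.edges_nodup, SimpleGraph.Walk.length_edges, hwn]

/-- Only edges of `T` are open, almost surely (Mathlib's `setBernoulli_ae_subset`). [folklore] -/
theorem bondPercolation_compl_subset_edgeSet_eq_zero [Countable V] (T : SimpleGraph V)
    (p : unitInterval) : bondPercolation T p {ω : BondConfig V | ω ⊆ T.edgeSet}ᶜ = 0 := by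
  rw [Set.compl_setOf]
  exact ae_iff.1 (setBernoulli_ae_subset (u := T.edgeSet) (p := p))

/-- **First-moment bound on a tree (Lyons–Peres 2016, Prop. 5.8 with `P[o ↔ y] = p^{|y|}`):
`θ_o(p) ≤ |T_n| · p^n` for every `n`.** [cite: LyonsPeres2016, Prop. 5.8 and (5.6)] -/
theorem theta_le_card_level_mul_pow [DecidableEq V] [Countable V] {T : SimpleGraph V}
    [T.LocallyFinite] (hT : T.IsTree) (o : V) (p : unitInterval) (n : ℕ) :
    theta T o p ≤ (level_finite T o n).toFinset.card * (p : ℝ) ^ n := by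
  set S := (level_finite T o n).toFinset with hS
  set A : V → Set (BondConfig V) := fun y => {ω | ∀ q : T.Path o y, ∀ e ∈ q.1.edges, e ∈ ω}
    with hA
  have hcover : percolatesAt o ∩ {ω | ω ⊆ T.edgeSet} ⊆ ⋃ y ∈ S, A y := by
    intro ω hω
    obtain ⟨y, hy, hyω⟩ := Set.mem_iUnion₂.1 (percolatesAt_inter_subset_iUnion hT o n hω)
    exact Set.mem_iUnion₂.2 ⟨y, (level_finite T o n).mem_toFinset.2 hy, hyω⟩
  calc theta T o p = (bondPercolation T p).real (percolatesAt o) := rfl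
    _ = (bondPercolation T p).real (percolatesAt o ∩ {ω | ω ⊆ T.edgeSet}) := by
        simp only [measureReal_def,
          measure_inter_conull (bondPercolation_compl_subset_edgeSet_eq_zero T p)]
    _ ≤ (bondPercolation T p).real (⋃ y ∈ S, A y) :=
        measureReal_mono hcover (measure_ne_top _ _)
    _ ≤ ∑ y ∈ S, (bondPercolation T p).real (A y) := measureReal_biUnion_finset_le S A
    _ = ∑ y ∈ S, (p : ℝ) ^ n := by
        refine Finset.sum_congr rfl fun y hy => ?_
        exact real_forall_path_edges_mem_eq_pow hT.isAcyclic o p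
          ((level_finite T o n).mem_toFinset.1 hy)
    _ = S.card * (p : ℝ) ^ n := by rw [Finset.sum_const, nsmul_eq_mul]

/-- `θ_o(p) ≤ |B(o, n)| · p^n` (since `|T_n| ≤ |B(o,n)|`).
[cite: LyonsPeres2016, Prop. 5.8, (5.6) and (1.1)] -/
theorem theta_le_ballVolume_mul_pow [DecidableEq V] [Countable V] {T : SimpleGraph V}
    [T.LocallyFinite] (hT : T.IsTree) (o : V) (p : unitInterval) (n : ℕ) :
    theta T o p ≤ ballVolume T o n * (p : ℝ) ^ n := by
  refine (theta_le_card_level_mul_pow hT o p n).trans ?_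
  exact mul_le_mul_of_nonneg_right (by exact_mod_cast card_level_le_ballVolume T o n)
    (pow_nonneg p.2.1 n)

/-! ### The named fact -/

/-- **Lyons–Peres 2016, (5.6) with (1.1): every locally finite tree with `p_c < 1` has
exponential growth** — discharge of `CriticalTreesExponentialGrowth`. With `p < 1`,
`θ := θ_0(p) > 0` and `a := 1/p > 1`: `θ a^m ≤ |B(0, m)| ≤ |B(x, m + d)|` (`d` the length of a
walk `x → 0`), so `c^n ≤ |B(x, n)|` for all large `n`, where `c = (1 + a)/2`.
[cite: LyonsPeres2016, (5.6) and (1.1)] -/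
theorem CriticalTreesExponentialGrowth_holds : CriticalTreesExponentialGrowth := by
  intro T hT hfin hpc x
  haveI : T.LocallyFinite := fun v => (hfin v).fintype
  obtain ⟨p, hp1, hθ⟩ := exists_theta_pos_of_criticalProb_lt_one T 0 hpc
  have hp0 : 0 < (p : ℝ) := coe_pos_of_theta_pos T 0 hθ
  obtain ⟨w⟩ := hT.connected.preconnected x 0
  -- constants: `a = 1/p > 1`, `c = (1 + a)/2 ∈ (1, a)`, `r = c/a < 1`, `K = θ / a^d`
  obtain ⟨a, ha⟩ : ∃ a : ℝ, a = 1 / p := ⟨_, rfl⟩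
  have ha1 : 1 < a := ha ▸ one_lt_one_div hp0 hp1
  have ha0 : 0 < a := one_pos.trans ha1
  have hpa : (p : ℝ) * a = 1 := by rw [ha, one_div, mul_inv_cancel₀ hp0.ne']
  obtain ⟨c, hc⟩ : ∃ c : ℝ, c = (1 + a) / 2 := ⟨_, rfl⟩
  have hc1 : 1 < c := by rw [hc]; linarith
  have hca : c < a := by rw [hc]; linarith
  obtain ⟨r, hr⟩ : ∃ r : ℝ, r = c / a := ⟨_, rfl⟩
  have hr0 : 0 ≤ r := by rw [hr]; exact div_nonneg (by linarith) ha0.le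
  have hr1 : r < 1 := by rw [hr]; exact (div_lt_one ha0).2 hca
  have hcr : c = r * a := by rw [hr, div_mul_cancel₀ _ ha0.ne']
  obtain ⟨K, hK⟩ : ∃ K : ℝ, K = theta T 0 p / a ^ w.length := ⟨_, rfl⟩
  have hK0 : 0 < K := by rw [hK]; exact div_pos hθ (pow_pos ha0 _)
  -- `θ a^m ≤ |B(0, m)|` for every `m`
  have key : ∀ m : ℕ, theta T 0 p * a ^ m ≤ (ballVolume T 0 m : ℝ) := by
    intro m
    have hpam : (p : ℝ) ^ m * a ^ m = 1 := by rw [← mul_pow, hpa, one_pow]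
    calc theta T 0 p * a ^ m ≤ (ballVolume T 0 m * (p : ℝ) ^ m) * a ^ m :=
          mul_le_mul_of_nonneg_right (theta_le_ballVolume_mul_pow hT 0 p m) (pow_nonneg ha0.le m)
      _ = ballVolume T 0 m := by rw [mul_assoc, hpam, mul_one]
  -- `r^n ≤ K` eventually
  have hev : ∀ᶠ n : ℕ in atTop, r ^ n ≤ K :=
    (tendsto_pow_atTop_nhds_zero_of_lt_one hr0 hr1).eventually (eventually_le_nhds hK0)
  obtain ⟨N, hN⟩ := eventually_atTop.1 hev
  refine ⟨c, hc1, eventually_atTop.2 ⟨N + w.length, fun n hn => ?_⟩⟩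
  obtain ⟨m, rfl⟩ : ∃ m, n = m + w.length := ⟨n - w.length, by omega⟩
  have h1 : c ^ (m + w.length) = r ^ (m + w.length) * a ^ (m + w.length) := by
    rw [hcr, mul_pow]
  have h2 : r ^ (m + w.length) * a ^ (m + w.length) ≤ K * a ^ (m + w.length) :=
    mul_le_mul_of_nonneg_right (hN _ (by omega)) (pow_nonneg ha0.le _)
  have h3 : K * a ^ (m + w.length) = theta T 0 p * a ^ m := by
    rw [hK, pow_add, div_mul_eq_mul_div, div_eq_iff (pow_ne_zero _ ha0.ne')]
    ring
  have h5 : (ballVolume T 0 m : ℝ) ≤ ballVolume T x (m + w.length) := by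
    exact_mod_cast Set.ncard_le_ncard (graphBall_subset_graphBall_add_length T w m)
      (graphBall_finite T x _)
  calc c ^ (m + w.length) = r ^ (m + w.length) * a ^ (m + w.length) := h1
    _ ≤ K * a ^ (m + w.length) := h2
    _ = theta T 0 p * a ^ m := h3
    _ ≤ ballVolume T 0 m := key m
    _ ≤ ballVolume T x (m + w.length) := h5

/-! ### Discharge of `TreesPercolatingAtCriticality` (Lyons–Peres 2016, Exercise 5.12) -/

/-- **Lyons–Peres 2016, Exercise 5.12 / Exercise 5.51 (b): there is a locally finite tree with
`0 < p_c < 1` percolating at `p_c`** — discharge of `TreesPercolatingAtCriticality`. The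
witness is the spherically symmetric tree `CritTree.tree` (`|T_n| = 2ⁿ 4^{size n}`, so that
`p_c = 1/2` and `θ_o(1/2) ≥ 1/2`: `CritTree.criticalProb_eq_half`,
`CritTree.half_le_theta_half`), transported to the vertex type `ℕ` along a bijection
`CritTree.Vert ≃ ℕ` sending the root to `0` (`θ`, `p_c`, `IsTree` and local finiteness are
invariant: `CritTree.theta_comap_equiv`, `CritTree.criticalProb_comap_equiv`,
`SimpleGraph.Iso.isTree_iff`, `CritTree.neighborSet_comap_equiv_finite`).
[cite: LyonsPeres2016, Exercise 5.12 and Exercise 5.51 (b)] -/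
theorem TreesPercolatingAtCriticality_holds : TreesPercolatingAtCriticality := by
  classical
  haveI : Infinite CritTree.Vert := Infinite.of_injective (fun n : ℕ => CritTree.mkV n 0)
    fun m n h => by simpa using congrArg (fun v : CritTree.Vert => v.1.1) h
  letI : Denumerable CritTree.Vert := Denumerable.ofEncodableOfInfinite CritTree.Vert
  set e₀ : CritTree.Vert ≃ ℕ := Denumerable.eqv CritTree.Vert with he₀
  set e : CritTree.Vert ≃ ℕ := e₀.trans (Equiv.swap (e₀ CritTree.root) 0) with he_def
  have he : e CritTree.root = 0 := by simp [he_def]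
  have hsymm : e.symm 0 = CritTree.root := by rw [← he, Equiv.symm_apply_apply]
  have hpc : criticalProb (CritTree.tree.comap e.symm) 0 = 1 / 2 := by
    rw [CritTree.criticalProb_comap_equiv, hsymm, CritTree.criticalProb_eq_half]
  refine ⟨CritTree.tree.comap e.symm, ?_, ?_, ?_, ?_, ?_⟩
  · exact (SimpleGraph.Iso.comap e.symm CritTree.tree).isTree_iff.2 CritTree.tree_isTree
  · exact CritTree.neighborSet_comap_equiv_finite CritTree.tree e.symm CritTree.neighborSet_finite
  · rw [hpc]; norm_num
  · rw [hpc]; norm_num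
  · have h : (⟨criticalProb (CritTree.tree.comap e.symm) 0, criticalProb_mem_Icc _ 0⟩ :
        unitInterval) = half := Subtype.ext hpc
    rw [h, CritTree.theta_comap_equiv, hsymm]
    exact lt_of_lt_of_le (by norm_num) CritTree.half_le_theta_half

end Literature.Barriers.CriticalPhenomena

end
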